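import Summits.QuantumFields.GaugeBoot.GaugeStringDualityRate
import HarnessLib

/-!
# Locality of the string moves and the quantitative gauge–string duality in terms of the distance to the boundary (gauge-boot, ADDENDUM 28 part Q3)

HONEST FRAMING (cell `pub-gaugeboot`, page 1 of every file): the venture produces certified bounds
on lattice expectations at stated coupling, gauge group, dimension and torus size; NOT a mass gap,
NOT a continuum limit, NOT a string tension; NOT Yang–Mills-summit-bearing (barriers
`FixedCouplingUltralocality`, `PerturbativeInvisibility`).  Finite-`N`, finite-volume `SO(N)` lattice gauge theory with
free boundary condition in `ℤ^d` at strong coupling; nothing about four-dimensional continuum Yang–Mills or a mass gap.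

## Content

The splitting and deformation operations of S. Chatterjee (Comm. Math. Phys. **366** (2019), §2.2) are LOCAL: every edge of a
splitting result is an edge of the split loop, and every edge of a deformation result `l ⊕ₓ p` / `l ⊖ₓ p` is an edge of
`l` or of the plaquette `p ∋ e = l_x`, whose corners are within distance `1` of the endpoints of `e`
(`exists_near_of_mem_posSplitAt` … `exists_near_of_mem_negDeformAt`).  Consequently the family
«every lattice point within Euclidean distance `n` of a vertex of `s` lies in `Λ`» is a depth grading compatible with the
moves (`ball_compatible`), and the sibling's quantitative duality takes its user-facing form:

★★★ `abs_phi_sub_trajectorySum_le_of_ball` — there are `β₀(d) > 0`, `C(d) ≥ 1` such that for every finite non-empty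
`Λ ⊂ ℤ^d`, every `N ≥ 2`, every `|β| ≤ β₀`, every `n` and every genuine loop sequence `s` whose vertices have their
`n`-neighbourhood inside `Λ`,
`|⟨W_{l₁}⋯W_{lₙ}⟩_{Λ,N,β}/Nⁿ − Σ_{X ∈ 𝒳(s)} w_β(X)| ≤ C^{|s|} (3 (3/4)ⁿ + 20/N)`.

Everything is `[folklore]` given the source.
-/

noncomputable section

open Finset Filter Topology
open Literature.Probability.LatticeModels (Site)
open Literature.MathematicalPhysics.QuantumLattice (ZdEdge ZdPlaquette plaquettesTouching plaquetteEdges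
  mem_plaquettesTouching_iff)
open Literature.MathematicalPhysics.QuantumFieldTheory (latticeNorm)
open Literature.MathematicalPhysics.QuantumFieldTheory.Chatterjee2019LargeN
open Literature.MathematicalPhysics.QuantumFieldTheory.Chatterjee2019LargeN.CoeffCatalanBoundProof
open Literature.MathematicalPhysics.QuantumFieldTheory.Chatterjee2019LargeN.Word
  (posMergeRot negMergeRot posDeform negDeform)

namespace Summit.QuantumFields.GaugeBoot

namespace StringDuality

variable {d : ℕ}

/-! ## Elementary facts: triangle inequality, letters of reduced words, endpoints -/

/-- Triangle inequality for the Euclidean length of lattice vectors. [folklore] -/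
theorem latticeNorm_sub_le (u v w : Site d) : latticeNorm (u - w) ≤ latticeNorm (u - v) + latticeNorm (v - w) := by
  unfold latticeNorm
  have h : (WithLp.toLp 2 fun i => ((u - w) i : ℝ) : EuclideanSpace ℝ (Fin d)) =
      (WithLp.toLp 2 fun i => ((u - v) i : ℝ)) + (WithLp.toLp 2 fun i => ((v - w) i : ℝ)) := by
    ext i
    simp only [Pi.sub_apply, Int.cast_sub, PiLp.add_apply]
    ring
  rw [h]
  exact norm_add_le _ _

/-- The letters of the cyclically reduced core of a word are letters of the word. [folklore] -/
theorem mem_of_mem_core {w : List (DEdge d)} {a : DEdge d} (h : a ∈ core w) : a ∈ w := by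
  unfold Literature.MathematicalPhysics.QuantumFieldTheory.Chatterjee2019LargeN.core at h
  have h1 : FreeGroup.reduceCyclically (FreeGroup.reduce w) <:+: FreeGroup.reduce w :=
    ⟨FreeGroup.reduceCyclically.conjugator (FreeGroup.reduce w),
      FreeGroup.invRev (FreeGroup.reduceCyclically.conjugator (FreeGroup.reduce w)),
      FreeGroup.reduceCyclically.conj_conjugator_reduceCyclically (FreeGroup.reduce w)⟩
  exact FreeGroup.reduce.red.sublist.subset (h1.sublist.subset h)

/-- The letters of `invRev w` are the inverses of the letters of `w`. [folklore] -/
theorem exists_of_mem_invRev {w : List (DEdge d)} {a : DEdge d} (h : a ∈ FreeGroup.invRev w) :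
    ∃ c ∈ w, a = DEdge.inv c := by
  unfold FreeGroup.invRev at h
  rw [List.mem_reverse, List.mem_map] at h
  obtain ⟨c, hc, rfl⟩ := h
  exact ⟨c, hc, rfl⟩

/-- The endpoints of `a⁻¹` are those of `a`. [folklore] -/
theorem isEnd_inv {u : Site d} {a : DEdge d} (h : u = DEdge.src (DEdge.inv a) ∨ u = DEdge.tgt (DEdge.inv a)) :
    u = DEdge.src a ∨ u = DEdge.tgt a := by
  rw [DEdge.src_inv, DEdge.tgt_inv] at h
  exact h.symm

/-- A letter is near itself. [folklore] -/
theorem near_self (a : DEdge d) :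
    ∀ u : Site d, u = DEdge.src a ∨ u = DEdge.tgt a →
      latticeNorm (u - DEdge.src a) ≤ 1 ∨ latticeNorm (u - DEdge.tgt a) ≤ 1 := by
  rintro u (rfl | rfl)
  · left; rw [sub_self, SOMasterLoop.latticeNorm_zero]; norm_num
  · right; rw [sub_self, SOMasterLoop.latticeNorm_zero]; norm_num

/-- Nearness only depends on the undirected letter. [folklore] -/
theorem near_inv {a' a : DEdge d}
    (h : ∀ u : Site d, u = DEdge.src a' ∨ u = DEdge.tgt a' →
      latticeNorm (u - DEdge.src a) ≤ 1 ∨ latticeNorm (u - DEdge.tgt a) ≤ 1) :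
    ∀ u : Site d, u = DEdge.src (DEdge.inv a') ∨ u = DEdge.tgt (DEdge.inv a') →
      latticeNorm (u - DEdge.src a) ≤ 1 ∨ latticeNorm (u - DEdge.tgt a) ≤ 1 :=
  fun u hu => h u (isEnd_inv hu)

/-! ## The plaquettes through an edge -/

/-- **The corners of a plaquette through the edge `e` are within distance `1` of the endpoints of `e`**: every endpoint
of every letter of the plaquette word of `p ∈ 𝒫⁺(e)` is within Euclidean distance `1` of `u(e)` or of `v(e)`.
[cite: Chatterjee2019LargeN, §2.1 (plaquettes as closed paths of length four), Theorem 3.6 (vertices at distance ≤ 1)] -/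
theorem near_of_mem_plaquetteWord {e a' : DEdge d} {p : ZdPlaquette d} (hp : p ∈ plaquettesAt e)
    (ha' : a' ∈ plaquetteWord p) :
    ∀ u : Site d, u = DEdge.src a' ∨ u = DEdge.tgt a' →
      latticeNorm (u - DEdge.src e) ≤ 1 ∨ latticeNorm (u - DEdge.tgt e) ≤ 1 := by
  -- the endpoints of `e = ((y, k), b)` are `y` and `y + e_k`
  have hend : ∀ u : Site d, latticeNorm (u - e.1.1) ≤ 1 ∨ latticeNorm (u - (e.1.1 + Pi.single e.1.2 1)) ≤ 1 →
      latticeNorm (u - DEdge.src e) ≤ 1 ∨ latticeNorm (u - DEdge.tgt e) ≤ 1 := by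
    intro u hu
    rcases e with ⟨⟨y, k⟩, b⟩
    cases b
    · simp only [DEdge.src, DEdge.tgt, Bool.false_eq_true, if_false] at hu ⊢
      exact hu.symm
    · simp only [DEdge.src, DEdge.tgt, if_true] at hu ⊢
      exact hu
  have h0 : ∀ v : Site d, latticeNorm (v - v) ≤ 1 := fun v => by
    rw [sub_self, SOMasterLoop.latticeNorm_zero]; norm_num
  have h1 : ∀ (v : Site d) (k : Fin d), latticeNorm (v + Pi.single k 1 - v) ≤ 1 := fun v k => by
    rw [add_sub_cancel_left, SOMasterLoop.latticeNorm_single_one]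
  have h1' : ∀ (v : Site d) (k : Fin d), latticeNorm (v - (v + Pi.single k 1)) ≤ 1 := fun v k => by
    rw [sub_add_eq_sub_sub, sub_self, zero_sub, SOMasterLoop.latticeNorm_neg, SOMasterLoop.latticeNorm_single_one]
  -- the corners of `p = (q, i, j)`
  obtain ⟨q, ⟨⟨i, j⟩, hij⟩⟩ := p
  rw [plaquettesAt, mem_plaquettesTouching_iff] at hp
  obtain ⟨f, hf⟩ := hp
  rw [Finset.mem_inter, Finset.mem_singleton] at hf
  obtain ⟨hf, hfe⟩ := hf
  -- every endpoint of a letter of the plaquette word is a corner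
  have hcorner : ∀ u : Site d, u = DEdge.src a' ∨ u = DEdge.tgt a' →
      u = q ∨ u = q + Pi.single i 1 ∨ u = q + Pi.single j 1 ∨ u = q + Pi.single i 1 + Pi.single j 1 := by
    intro u hu
    simp only [plaquetteWord, List.mem_cons, List.not_mem_nil, or_false] at ha'
    rcases ha' with rfl | rfl | rfl | rfl <;>
      simp only [DEdge.src, DEdge.tgt, if_true, Bool.false_eq_true, if_false] at hu <;>
      rcases hu with rfl | rfl
    · exact Or.inl rfl
    · exact Or.inr (Or.inr (Or.inl rfl))
    · exact Or.inr (Or.inr (Or.inl rfl))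
    · exact Or.inr (Or.inr (Or.inr (by rw [add_right_comm])))
    · exact Or.inr (Or.inr (Or.inr rfl))
    · exact Or.inr (Or.inl rfl)
    · exact Or.inr (Or.inl rfl)
    · exact Or.inl rfl
  intro u hu
  apply hend
  rw [← hfe]
  have hc := hcorner u hu
  simp only [plaquetteEdges, Finset.mem_insert, Finset.mem_singleton] at hf
  rcases hf with rfl | rfl | rfl | rfl <;> rcases hc with rfl | rfl | rfl | rfl
  -- edge `(q, i)`: endpoints `q`, `q + e_i`
  · exact Or.inl (h0 _)
  · exact Or.inr (h0 _)
  · exact Or.inl (h1 _ _)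
  · exact Or.inr (by rw [add_sub_cancel_left, SOMasterLoop.latticeNorm_single_one])
  -- edge `(q + e_i, j)`: endpoints `q + e_i`, `q + e_i + e_j`
  · exact Or.inl (h1' _ _)
  · exact Or.inl (h0 _)
  · refine Or.inr ?_
    rw [show q + Pi.single j 1 - (q + Pi.single i 1 + Pi.single j 1) = -Pi.single i 1 by abel,
      SOMasterLoop.latticeNorm_neg, SOMasterLoop.latticeNorm_single_one]
  · exact Or.inr (h0 _)
  -- edge `(q + e_j, i)`: endpoints `q + e_j`, `q + e_j + e_i`
  · exact Or.inl (h1' _ _)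
  · refine Or.inr ?_
    rw [show q + Pi.single i 1 - (q + Pi.single j 1 + Pi.single i 1) = -Pi.single j 1 by abel,
      SOMasterLoop.latticeNorm_neg, SOMasterLoop.latticeNorm_single_one]
  · exact Or.inl (h0 _)
  · refine Or.inr ?_
    rw [show q + Pi.single i 1 + Pi.single j 1 - (q + Pi.single j 1 + Pi.single i 1) = 0 by abel,
      SOMasterLoop.latticeNorm_zero]
    norm_num
  -- edge `(q, j)`: endpoints `q`, `q + e_j`
  · exact Or.inl (h0 _)
  · exact Or.inl (h1 _ _)
  · exact Or.inr (h0 _)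
  · refine Or.inr ?_
    rw [show q + Pi.single i 1 + Pi.single j 1 - (q + Pi.single j 1) = Pi.single i 1 by abel,
      SOMasterLoop.latticeNorm_single_one]

/-! ## Locality of the four kinds of moves -/

/-- The loops of a replacement are old loops or inserted words. [cite: Chatterjee2019LargeN, §2.2 (operations on loop sequences)] -/
theorem mem_or_mem_of_mem_replaceAt {s : LoopSeq d} {i : ℕ} {ws : List (List (DEdge d))} {l' : List (DEdge d)}
    (h : l' ∈ s.replaceAt i ws) : l' ∈ s ∨ l' ∈ ws := by
  unfold LoopSeq.replaceAt LoopSeq.prune at h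
  rw [List.mem_filter] at h
  have h' := h.1
  rw [List.mem_append, List.mem_append] at h'
  rcases h' with (h' | h') | h'
  · exact Or.inl (List.mem_of_mem_take h')
  · exact Or.inr h'
  · exact Or.inl (List.mem_of_mem_drop h')

/-- **Splittings are local**: every letter of a loop of a positive splitting result is (near) a letter of `s`.
[cite: Chatterjee2019LargeN, §2.2 (positive splitting: ×¹, ×² are made of letters of l)] -/
theorem exists_near_of_mem_posSplitAt {s : LoopSeq d} (o : SameIdx s) {l' : List (DEdge d)} (hl' : l' ∈ s.posSplitAt o)
    {a' : DEdge d} (ha' : a' ∈ l') :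
    ∃ l ∈ s, ∃ a ∈ l, ∀ u : Site d, u = DEdge.src a' ∨ u = DEdge.tgt a' →
      latticeNorm (u - DEdge.src a) ≤ 1 ∨ latticeNorm (u - DEdge.tgt a) ≤ 1 := by
  rcases mem_or_mem_of_mem_replaceAt hl' with h | h
  · exact ⟨l', h, a', ha', near_self a'⟩
  · refine ⟨s.get o.1, List.get_mem s o.1, a', ?_, near_self a'⟩
    simp only [List.mem_cons, List.not_mem_nil, or_false] at h
    rcases h with rfl | rfl
    · have h1 := mem_of_mem_core ha'
      rw [List.mem_cons] at h1
      rcases h1 with rfl | h1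
      · exact List.get_mem _ _
      · exact (List.mem_rotate.mp (List.mem_of_mem_drop h1))
    · have h1 := mem_of_mem_core ha'
      rw [List.mem_append, List.mem_singleton] at h1
      rcases h1 with h1 | rfl
      · exact List.mem_rotate.mp (List.mem_of_mem_drop (List.mem_of_mem_take h1))
      · exact List.get_mem _ _

/-- **Negative splittings are local.** [cite: Chatterjee2019LargeN, §2.2 (negative splitting)] -/
theorem exists_near_of_mem_negSplitAt {s : LoopSeq d} (o : InvIdx s) {l' : List (DEdge d)} (hl' : l' ∈ s.negSplitAt o)
    {a' : DEdge d} (ha' : a' ∈ l') :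
    ∃ l ∈ s, ∃ a ∈ l, ∀ u : Site d, u = DEdge.src a' ∨ u = DEdge.tgt a' →
      latticeNorm (u - DEdge.src a) ≤ 1 ∨ latticeNorm (u - DEdge.tgt a) ≤ 1 := by
  rcases mem_or_mem_of_mem_replaceAt hl' with h | h
  · exact ⟨l', h, a', ha', near_self a'⟩
  · refine ⟨s.get o.1, List.get_mem s o.1, a', ?_, near_self a'⟩
    simp only [List.mem_cons, List.not_mem_nil, or_false] at h
    rcases h with rfl | rfl
    · exact List.mem_rotate.mp (List.mem_of_mem_drop (mem_of_mem_core ha'))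
    · exact List.mem_rotate.mp (List.mem_of_mem_drop (List.mem_of_mem_take (mem_of_mem_core ha')))

/-- Letters of the merged words `posMergeRot L M` / `negMergeRot L M` come from `L`, from `M`, or are inverses of letters
of `M`. [cite: Chatterjee2019LargeN, §2.2 (mergers and deformations)] -/
theorem mem_mergeRot {L M : List (DEdge d)} {a' : DEdge d}
    (h : a' ∈ posMergeRot L M ∨ a' ∈ negMergeRot L M) :
    a' ∈ L ∨ a' ∈ M ∨ ∃ c ∈ M, a' = DEdge.inv c := by
  match L, M, h with
  | [], M, h => simp [posMergeRot, negMergeRot] at h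
  | e :: b, [], h => simp [posMergeRot, negMergeRot] at h
  | e :: b, a :: d', h =>
    simp only [posMergeRot, negMergeRot] at h
    have hM : ∀ c ∈ d', c ∈ a :: d' := fun c hc => List.mem_cons_of_mem _ hc
    rcases h with h | h <;> split_ifs at h <;> have h := mem_of_mem_core h
    · simp only [List.mem_cons, List.mem_append] at h
      rcases h with (rfl | h) | (rfl | h)
      · exact Or.inl List.mem_cons_self
      · exact Or.inr (Or.inl (hM _ h))
      · exact Or.inl List.mem_cons_self
      · exact Or.inl (List.mem_cons_of_mem _ h)
    · simp only [List.mem_cons, List.mem_append] at h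
      rcases h with (rfl | h) | (rfl | h)
      · exact Or.inl List.mem_cons_self
      · obtain ⟨c, hc, rfl⟩ := exists_of_mem_invRev h
        exact Or.inr (Or.inr ⟨c, hM _ hc, rfl⟩)
      · exact Or.inl List.mem_cons_self
      · exact Or.inl (List.mem_cons_of_mem _ h)
    · rw [List.mem_append] at h
      rcases h with h | h
      · obtain ⟨c, hc, rfl⟩ := exists_of_mem_invRev h
        exact Or.inr (Or.inr ⟨c, hM _ hc, rfl⟩)
      · exact Or.inl (List.mem_cons_of_mem _ h)
    · rw [List.mem_append] at h
      rcases h with h | h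
      · exact Or.inr (Or.inl (hM _ h))
      · exact Or.inl (List.mem_cons_of_mem _ h)

/-- **Deformations are local**: every letter of `l ⊕ₓ p` / `l ⊖ₓ p` is a letter of `l` or (the inverse of) a letter of
the plaquette `p ∋ l_x`, whose endpoints are within distance `1` of those of `l_x`.
[cite: Chatterjee2019LargeN, §2.2 (deformations l ⊕ₓ p, l ⊖ₓ p)] -/
theorem exists_near_of_mem_deform {l : List (DEdge d)} (x : Fin l.length) {p : ZdPlaquette d}
    (hp : p ∈ plaquettesAt (l.get x)) {a' : DEdge d}
    (h : a' ∈ posDeform l x p ∨ a' ∈ negDeform l x p) :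
    ∃ a ∈ l, ∀ u : Site d, u = DEdge.src a' ∨ u = DEdge.tgt a' →
      latticeNorm (u - DEdge.src a) ≤ 1 ∨ latticeNorm (u - DEdge.tgt a) ≤ 1 := by
  unfold Literature.MathematicalPhysics.QuantumFieldTheory.Chatterjee2019LargeN.Word.posDeform
    Literature.MathematicalPhysics.QuantumFieldTheory.Chatterjee2019LargeN.Word.negDeform at h
  rcases mem_mergeRot h with h | h | ⟨c, hc, rfl⟩
  · exact ⟨a', List.mem_rotate.mp h, near_self a'⟩
  · exact ⟨l.get x, List.get_mem l x, near_of_mem_plaquetteWord hp (List.mem_rotate.mp h)⟩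
  · exact ⟨l.get x, List.get_mem l x, near_inv (near_of_mem_plaquetteWord hp (List.mem_rotate.mp hc))⟩

/-- **Positive deformations of a loop sequence are local.** [cite: Chatterjee2019LargeN, §2.2 (𝔻⁺(s))] -/
theorem exists_near_of_mem_posDeformAt {s : LoopSeq d} (o : DeformIdx s) {l' : List (DEdge d)}
    (hl' : l' ∈ s.posDeformAt o) {a' : DEdge d} (ha' : a' ∈ l') :
    ∃ l ∈ s, ∃ a ∈ l, ∀ u : Site d, u = DEdge.src a' ∨ u = DEdge.tgt a' →
      latticeNorm (u - DEdge.src a) ≤ 1 ∨ latticeNorm (u - DEdge.tgt a) ≤ 1 := by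
  rcases mem_or_mem_of_mem_replaceAt hl' with h | h
  · exact ⟨l', h, a', ha', near_self a'⟩
  · rw [List.mem_singleton] at h
    subst h
    obtain ⟨a, ha, hnear⟩ := exists_near_of_mem_deform o.2.1 o.2.2.2 (Or.inl ha')
    exact ⟨s.get o.1, List.get_mem s o.1, a, ha, hnear⟩

/-- **Negative deformations of a loop sequence are local.** [cite: Chatterjee2019LargeN, §2.2 (𝔻⁻(s))] -/
theorem exists_near_of_mem_negDeformAt {s : LoopSeq d} (o : DeformIdx s) {l' : List (DEdge d)}
    (hl' : l' ∈ s.negDeformAt o) {a' : DEdge d} (ha' : a' ∈ l') :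
    ∃ l ∈ s, ∃ a ∈ l, ∀ u : Site d, u = DEdge.src a' ∨ u = DEdge.tgt a' →
      latticeNorm (u - DEdge.src a) ≤ 1 ∨ latticeNorm (u - DEdge.tgt a) ≤ 1 := by
  rcases mem_or_mem_of_mem_replaceAt hl' with h | h
  · exact ⟨l', h, a', ha', near_self a'⟩
  · rw [List.mem_singleton] at h
    subst h
    obtain ⟨a, ha, hnear⟩ := exists_near_of_mem_deform o.2.1 o.2.2.2 (Or.inr ha')
    exact ⟨s.get o.1, List.get_mem s o.1, a, ha, hnear⟩

/-! ## The `n`-neighbourhood condition is a depth grading compatible with the moves -/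

/-- One step: if the `(r+1)`-neighbourhood of the vertices of `s` lies in `Λ` and every letter of `s'` is near a letter
of `s`, then the `r`-neighbourhood of the vertices of `s'` lies in `Λ`. [folklore] -/
theorem ball_step {Λ : Finset (Site d)} {r : ℝ} {s s' : LoopSeq d}
    (hs : ∀ l ∈ s, ∀ a ∈ l, ∀ v : Site d,
      latticeNorm (v - DEdge.src a) ≤ r + 1 ∨ latticeNorm (v - DEdge.tgt a) ≤ r + 1 → v ∈ Λ)
    (hnear : ∀ l' ∈ s', ∀ a' ∈ l', ∃ l ∈ s, ∃ a ∈ l, ∀ u : Site d, u = DEdge.src a' ∨ u = DEdge.tgt a' →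
      latticeNorm (u - DEdge.src a) ≤ 1 ∨ latticeNorm (u - DEdge.tgt a) ≤ 1) :
    ∀ l' ∈ s', ∀ a' ∈ l', ∀ v : Site d,
      latticeNorm (v - DEdge.src a') ≤ r ∨ latticeNorm (v - DEdge.tgt a') ≤ r → v ∈ Λ := by
  intro l' hl' a' ha' v hv
  obtain ⟨l, hl, a, ha, hn⟩ := hnear l' hl' a' ha'
  -- the endpoint `u` of `a'` close to `v`
  obtain ⟨u, hu, hvu⟩ : ∃ u : Site d, (u = DEdge.src a' ∨ u = DEdge.tgt a') ∧ latticeNorm (v - u) ≤ r := by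
    rcases hv with hv | hv
    · exact ⟨_, Or.inl rfl, hv⟩
    · exact ⟨_, Or.inr rfl, hv⟩
  refine hs l hl a ha v ?_
  rcases hn u hu with h | h
  · exact Or.inl ((latticeNorm_sub_le v u _).trans (by linarith))
  · exact Or.inr ((latticeNorm_sub_le v u _).trans (by linarith))

/-- **The `n`-neighbourhood conditions form a depth grading compatible with the moves** (the hypothesis `Good` of
`abs_phi_sub_trajectorySum_le`). [cite: Chatterjee2019LargeN, Theorem 3.6 (hypothesis: vertices at distance ≤ 1 in Λ)] -/
theorem ball_compatible (Λ : Finset (Site d)) (n : ℕ) (s : LoopSeq d)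
    (h : ∀ l ∈ s, ∀ a ∈ l, ∀ v : Site d,
      latticeNorm (v - DEdge.src a) ≤ (n + 1 : ℕ) ∨ latticeNorm (v - DEdge.tgt a) ≤ (n + 1 : ℕ) → v ∈ Λ) :
    (∀ l ∈ s, ∀ a ∈ l, ∀ v : Site d,
        latticeNorm (v - DEdge.src a) ≤ 1 ∨ latticeNorm (v - DEdge.tgt a) ≤ 1 → v ∈ Λ) ∧
      (∀ o : SameIdx s, ∀ l ∈ s.posSplitAt o, ∀ a ∈ l, ∀ v : Site d,
        latticeNorm (v - DEdge.src a) ≤ (n : ℕ) ∨ latticeNorm (v - DEdge.tgt a) ≤ (n : ℕ) → v ∈ Λ) ∧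
      (∀ o : InvIdx s, ∀ l ∈ s.negSplitAt o, ∀ a ∈ l, ∀ v : Site d,
        latticeNorm (v - DEdge.src a) ≤ (n : ℕ) ∨ latticeNorm (v - DEdge.tgt a) ≤ (n : ℕ) → v ∈ Λ) ∧
      (∀ o : DeformIdx s, ∀ l ∈ s.posDeformAt o, ∀ a ∈ l, ∀ v : Site d,
        latticeNorm (v - DEdge.src a) ≤ (n : ℕ) ∨ latticeNorm (v - DEdge.tgt a) ≤ (n : ℕ) → v ∈ Λ) ∧
      (∀ o : DeformIdx s, ∀ l ∈ s.negDeformAt o, ∀ a ∈ l, ∀ v : Site d,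
        latticeNorm (v - DEdge.src a) ≤ (n : ℕ) ∨ latticeNorm (v - DEdge.tgt a) ≤ (n : ℕ) → v ∈ Λ) := by
  have h' : ∀ l ∈ s, ∀ a ∈ l, ∀ v : Site d,
      latticeNorm (v - DEdge.src a) ≤ (n : ℝ) + 1 ∨ latticeNorm (v - DEdge.tgt a) ≤ (n : ℝ) + 1 → v ∈ Λ := by
    intro l hl a ha v hv
    refine h l hl a ha v ?_
    push_cast
    exact hv
  refine ⟨fun l hl a ha v hv => h l hl a ha v ?_, fun o => ball_step h' fun l' hl' a' ha' =>
      exists_near_of_mem_posSplitAt o hl' ha', fun o => ball_step h' fun l' hl' a' ha' =>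
      exists_near_of_mem_negSplitAt o hl' ha', fun o => ball_step h' fun l' hl' a' ha' =>
      exists_near_of_mem_posDeformAt o hl' ha', fun o => ball_step h' fun l' hl' a' ha' =>
      exists_near_of_mem_negDeformAt o hl' ha'⟩
  have h1 : (1 : ℝ) ≤ ((n + 1 : ℕ) : ℝ) := by exact_mod_cast Nat.le_add_left 1 n
  rcases hv with hv | hv
  · exact Or.inl (hv.trans h1)
  · exact Or.inr (hv.trans h1)

variable (d)

/-- ★★★ **Quantitative gauge–string duality, in terms of the distance to the boundary.**  There are `β₀(d) > 0` and
`C(d) ≥ 1` such that for every finite non-empty `Λ ⊂ ℤ^d` (`d ≥ 2`), every `N ≥ 2`, every `|β| ≤ β₀`, every `n` and every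
loop sequence `s = (l₁, …, lₙ)` in minimal representation all of whose vertices have their Euclidean `n`-neighbourhood in
`Λ`:  `|⟨W_{l₁}⋯W_{lₙ}⟩_{Λ,N,β}/Nⁿ − Σ_{X ∈ 𝒳(s)} w_β(X)| ≤ C^{|s|} (3 (3/4)ⁿ + 20/N)`.
[cite: Chatterjee2019LargeN, Theorem 3.1 (qualitative form), Theorem 3.6] -/
theorem abs_phi_sub_trajectorySum_le_of_ball (hd : 2 ≤ d) :
    ∃ β₀ : ℝ, 0 < β₀ ∧ ∃ C : ℝ, 1 ≤ C ∧
      ∀ Λ : Finset (Site d), Λ.Nonempty → ∀ N : ℕ, 2 ≤ N → ∀ β : ℝ, |β| ≤ β₀ →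
        ∀ (n : ℕ) (s : LoopSeq d), IsLoopSeq s →
          (∀ l ∈ s, ∀ a ∈ l, ∀ v : Site d,
              latticeNorm (v - DEdge.src a) ≤ n ∨ latticeNorm (v - DEdge.tgt a) ≤ n → v ∈ Λ) →
            |phi N β Λ s - ∑' X : Trajectory s, X.weight β| ≤ C ^ s.len * (3 * (3 / 4 : ℝ) ^ n + 20 / N) := by
  obtain ⟨β₀, hβ₀, C, hC1, H⟩ := abs_phi_sub_trajectorySum_le_pow d hd
  refine ⟨β₀, hβ₀, C, hC1, fun Λ hΛ N hN β hβ n s hs hball => ?_⟩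
  exact H Λ hΛ N hN β hβ
    (fun m t => ∀ l ∈ t, ∀ a ∈ l, ∀ v : Site d,
      latticeNorm (v - DEdge.src a) ≤ (m : ℕ) ∨ latticeNorm (v - DEdge.tgt a) ≤ (m : ℕ) → v ∈ Λ)
    (fun m t ht => ball_compatible Λ m t ht) n s hs hball

end StringDuality

end Summit.QuantumFields.GaugeBoot

end
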